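import Mathlib
import Summits.NavierStokesRegularity.NavierStokesRegularity.Theorems.TaoLadderRungTwoBreakOneShiftWindowGridE
import Summits.NavierStokesRegularity.NavierStokesRegularity.Theorems.TaoLadderRungTwoBreakOneShiftWindowK3GlueC
import Summits.NavierStokesRegularity.NavierStokesRegularity.Theorems.TaoLadderRungTwoBreakOneShiftWindowGlGlueC
import HarnessLib

/-!
# The one-shift window system, LVIII: THE ROW GLUE ON THE END-OF-STEP PRODUCT CHAIN — parts L/LIII/LIV verbatim
# (`exists_matches_of_gridCE`, `K1_of_gridCE`; part LIX: `K3_of_gridCE`, `gfac_mem_of_gridCE`, `gl_of_gridCE`) with the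
# product Boolean `prodOKE` of part LVII on the regular steps `s < S` and `prodOK S` on the final step: (K1), (K3) and
# the `g`-hull of a one-shift row from Booleans over emitted dyadic data + instance facts, now with a slope chain
# whose width is the second-order variation over the box instead of `Σ_s h_s‖Df‖`
# (cell harvest/h2-tao-ladder, seat p2; rung1/KERNEL-CHEAP-REPLAY-SPEC.md §10, RUNG1-P2G14-REPORT §67; support for
# K1(1) = `NoSurvivingDSSOne`, stmt-NavierStokesRegularity-20205)

MODEL lattice ODEs only (Tao 2016 §4 normal form on Tao's shift set `S`); nothing here is a statement about the
Navier–Stokes equations; no item is closed; no instance is evaluated here. Generic in the frame `F`, the numbering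
`e` and the term index `κ`.
-/

noncomputable section

-- the sub-problem namespace repeats the summit name by design (D-0017)
set_option linter.dupNamespace false

namespace Summit.NavierStokesRegularity.NavierStokesRegularity.Theorems

namespace DSSOneShift

open Set Finset Metric Filter Topology TopologicalSpace
open Literature.Analysis.ODE Literature.Analysis.FluidPDE Literature.Analysis.FluidPDE.TaoCascade
open Summit.NavierStokesRegularity.NavierStokesRegularity.Theorems.TaylorModelCert
open Summit.NavierStokesRegularity.NavierStokesRegularity.Theorems.TaylorModelReadout
open Summit.NavierStokesRegularity.NavierStokesRegularity.Theorems.CertificateGlueOn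

variable {m : ℕ}

namespace OneShiftFrame

variable (F : OneShiftFrame m)

section Glue

variable {ε₀ : ℝ} {α : Fin m → Fin m → Fin m → ℤ × ℤ × ℤ → ℝ} {R : ℤ → ℝ}
variable {g : GridCD} {kd : KrawD} {k3 : K3D} {e : F.SIdx ≃ Fin g.n}
variable {κ : Type*} [Fintype κ]

/-- **PER PAIR: A `Matches` INSTANCE AND THE RESIDUAL-SLOPE REPRESENTATION.** See the module docstring.
[cite: Tao2016AveragedNS, §5.3; WalawskaWilczak2016, §2.2 Lemma 2; Moore1979, §3.2 and §8.1; cell vocabulary, harvest/h2-tao-ladder rung1/KERNEL-CHEAP-REPLAY-SPEC.md §9 (G)] -/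
theorem exists_matches_of_gridCE (hε : 0 ≤ ε₀) (hα : IsCancellingCoeff α)
    (hEb : ∀ i, |F.tubeC i (-1)| + F.tubeR (-1) ≤ F.Eb) (hEt : ∀ i, |F.tubeC i F.W| + F.tubeR F.W ≤ F.Et)
    (M : F.FrameMatch g.toGridD kd e R) (hkn : kd.rs.n = g.n)
    (Tc : ℕ → κ → BTerm F.SIdx) (rows : F.SIdx → List κ) (Tf : F.Space → ℝ → κ → BTerm F.SIdx)
    (hTf : ∀ u, F.AdmLip R u → ∀ t x, termField (Tf u t) x = F.wfieldFlat ε₀ α (F.preclampTail u) t x)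
    (hRDc : ∀ s ≤ g.S, IsRTEncl (g.es e M.hn s) (Tc s) (Tc s) rows (g.step s).RD)
    (hRD : ∀ u, F.AdmLip R u → ∀ s ≤ g.S, ∀ r ∈ Ico 0 (g.h s).toReal,
      IsRTEncl (g.es e M.hn s) (Tc s) (Tf u (g.t s + r)) rows (g.step s).RD)
    (hstep : ∀ s ≤ g.S, g.stepOK s = true) (hinit : g.initOK = true) (hprod : ∀ s < g.S, g.prodOKE s = true)
    (hprodS : g.prodOK g.S = true)
    (hpwf : ∀ s ≤ g.S, g.pwfOK s = true) (hpsub : ∀ s ≤ g.S, g.psubOK s = true)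
    (hplink : ∀ s < g.S, g.plinkOK s = true) (hwlink : ∀ s < g.S, g.wlinkOK s = true) (hK1 : g.linkK1 kd = true)
    (hP0 : (fun c : F.SIdx => F.yc c.1 ((c.2 : ℕ) : ℤ)) ∈ boxSet (boxOf e (g.P 0)))
    {u v : F.Space} (hu : F.AdmLip R u) (hv : F.AdmLip R v) (huv : u.2.2 = v.2.2) :
    ∃ (θ' : ℝ) (ρ : Fin m → ℝ) (φ : Fin m → ℤ → ℝ) (U : Matrix F.SIdx F.SIdx ℝ),
      kd.rs.Matches F (e.trans (finCongr hkn.symm)) M.hW1 M.hDW (gfac (F.runAt ε₀ α u)) (rsqrtDeriv θ')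
        (F.runAt ε₀ α u) (F.runAt ε₀ α v) φ U ρ (fun i => F.preclampTail v i F.W (F.preclampTau v)) ∧
      ∀ r, F.coord (F.gval ε₀ α u) r - F.coord (F.gval ε₀ α v) r =
        ∑ c, F.resSlope (gfac (F.runAt ε₀ α u)) (rsqrtDeriv θ') (F.runAt ε₀ α u) (F.runAt ε₀ α v)
          (F.runSlopeOf (F.slopeOfFlat U) φ) ρ (fun i => F.preclampTail v i F.W (F.preclampTau v)) r c *
          (F.coord (F.winPart u) c - F.coord (F.winPart v) c) := by
  classical
  have hW1 := M.hW1
  have hDW := M.hDW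
  have hn := M.hn
  have hW : 0 < F.W := lt_trans zero_lt_one hW1
  -- the link Boolean
  obtain ⟨-, hZb, hUb, hFv, he0, hG, hGam, -⟩ := g.of_linkK1 hK1
  -- the numbering of the residual-slope data
  set ek : F.SIdx ≃ Fin kd.rs.n := e.trans (finCongr hkn.symm) with hekdef
  have hek : ∀ p : F.SIdx, ((ek p : Fin kd.rs.n) : ℕ) = (e p : ℕ) := fun p => by simp [hekdef]
  -- facts of the final step
  have hchkS : (g.step g.S).check = true := by
    have := hstep g.S le_rfl
    simp only [GridD.stepOK, Bool.and_eq_true, decide_eq_true_eq] at this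
    exact this.1
  have hc' : (g.step g.S).toRoughStepD.check = true ∧ (g.step g.S).checkPair = true := by
    simpa [PairStepD.check, Bool.and_eq_true] using hchkS
  have hrc' : (g.step g.S).toRoughStepD.centre.check = true ∧ (g.step g.S).toRoughStepD.checkKZ = true := by
    simpa [RoughStepD.check, Bool.and_eq_true] using hc'.1
  obtain ⟨heta, hKZ⟩ := (g.step g.S).toRoughStepD.of_checkKZ hrc'.2
  have hcw := (g.step g.S).toRoughStepD.centre.of_checkWith (by rw [← CentreStepD.check_eq]; exact hrc'.1)
  have hwfS : ∀ c < (g.step g.S).n, wfsD (IntervalD.aget (g.step g.S).S c) = true := fun c hc => (hcw.2.2.1 c hc).2.1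
  have hZ : ∀ c < (g.step g.S).n, 0 ≤ (RoughStepD.dget (g.step g.S).Zh c).toReal := fun c hc => (hKZ c hc).1
  have hwfH : ∀ c < (g.step g.S).n, wfD (IntervalD.aget (g.step g.S).Hs c) = true := fun c hc =>
    (Dyad.ble_iff _ _).2 ((g.step g.S).toRoughStepD.wf_Hs hwfS hZ heta hc)
  -- reading the final hull as `mem` facts, in `Zb`
  have hHs : ∀ x ∈ boxSet (boxOf e (g.step g.S).Hs), ∀ c, IntervalD.mem (x c) (IntervalD.aget (g.step g.S).Hs (e c)) := by
    intro x hx c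
    have hx' : x ∈ boxSet (boxOf (g.es e hn g.S) (g.step g.S).Hs) := by rw [GridD.boxOf_es]; exact hx
    have h := (g.step g.S).toRoughStepD.mem_of_mem_Hs (g.es e hn g.S) hwfS hZ heta hx' c
    rw [GridD.es_val] at h
    exact h
  have hHsZb : ∀ x ∈ boxSet (boxOf e (g.step g.S).Hs), ∀ c, IntervalD.mem (x c) (IntervalD.aget kd.rs.Zb (ek c)) := by
    intro x hx c
    rw [hek]
    have hcn : (e c : ℕ) < g.n := (e c).isLt
    exact IntervalD.mem_of_subset (hZb _ hcn) (hHs x hx c)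
  -- same tails
  have hT : F.preclampTail v = F.preclampTail u := by
    funext i k t; simp only [preclampTail, huv]
  -- the two runs
  set Su := F.windowRunMap ε₀ α (F.preclampY u) (F.preclampTail u) with hSudef
  set Sv := F.windowRunMap ε₀ α (F.preclampY v) (F.preclampTail v) with hSvdef
  have hSu : F.IsRunFrom ε₀ α (F.preclampY u) (F.preclampTail u) Su := F.isRunFrom_windowRunMap hε hW hα hEb hEt hu.1
  have hSv : F.IsRunFrom ε₀ α (F.preclampY v) (F.preclampTail v) Sv := F.isRunFrom_windowRunMap hε hW hα hEb hEt hv.1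
  have hfu : ∀ t ∈ Icc 0 F.τhi, HasDerivWithinAt (F.flatRun Su) (termField (Tf u t) (F.flatRun Su t)) (Icc 0 F.τhi) t := by
    intro t ht
    have h := F.hasDerivWithinAt_flatRun hSu ht
    rwa [← hTf u hu t] at h
  have hfv : ∀ t ∈ Icc 0 F.τhi, HasDerivWithinAt (F.flatRun Sv) (termField (Tf u t) (F.flatRun Sv t)) (Icc 0 F.τhi) t := by
    intro t ht
    have h := F.hasDerivWithinAt_flatRun hSv ht
    rwa [hT, ← hTf u hu t] at h
  -- start boxes
  have ha : F.flatRun Su 0 ∈ boxSet (boxOf e (g.step 0).W) := M.hW0 _ fun c => F.abs_flatRun_zero_sub_yc_le hSu c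
  have hb : F.flatRun Sv 0 ∈ boxSet (boxOf e (g.step 0).W) := M.hW0 _ fun c => F.abs_flatRun_zero_sub_yc_le hSv c
  -- times
  have hτc := F.τc_gt
  have hrτ := F.rτ_pos
  have htS' : g.t g.S ≤ F.τhi := M.htS.trans (by unfold τhi; linarith)
  have hTS' : F.τhi ≤ g.t g.S + (g.h g.S).toReal := M.hTS.le
  have hτu := F.preclampTau_mem_box u
  have hτv := F.preclampTau_mem_box v
  have hτu' : F.preclampTau u ∈ Icc (g.t g.S) F.τhi := ⟨M.htS.trans hτu.1, hτu.2⟩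
  have hτv' : F.preclampTau v ∈ Icc (g.t g.S) F.τhi := ⟨M.htS.trans hτv.1, hτv.2⟩
  -- the reference run: zero scaled window coordinates, the tails of `u`
  have hw : F.AdmLip R (F.zeroWin u) := F.admLip_zeroWin hu
  set Sw := F.windowRunMap ε₀ α (F.preclampY (F.zeroWin u)) (F.preclampTail (F.zeroWin u)) with hSwdef
  have hSw : F.IsRunFrom ε₀ α (F.preclampY (F.zeroWin u)) (F.preclampTail (F.zeroWin u)) Sw :=
    F.isRunFrom_windowRunMap hε hW hα hEb hEt hw.1
  have hfw : ∀ t ∈ Icc 0 F.τhi, HasDerivWithinAt (F.flatRun Sw) (termField (Tf u t) (F.flatRun Sw t)) (Icc 0 F.τhi) t := by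
    intro t ht
    have h := F.hasDerivWithinAt_flatRun hSw ht
    rwa [F.preclampTail_zeroWin, ← hTf u hu t] at h
  have hSw0 : F.flatRun Sw 0 = fun c : F.SIdx => F.yc c.1 ((c.2 : ℕ) : ℤ) := funext fun c => F.flatRun_zeroWin_zero hSw c
  -- the grid
  obtain ⟨hslope, hhull⟩ := g.exists_flowSlope_of_gridC_uptoE e hn hRDc (hRD u hu) hstep hinit hprod hprodS hpwf hpsub hplink
    hwlink htS' hTS' hP0 hSw0 hfw ha hb (Su := F.flatRun Su) (Sv := F.flatRun Sv) rfl rfl hfu hfv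
  obtain ⟨U, hUV, hUrep⟩ := hslope (F.preclampTau u) hτu'
  -- the flow slope at the flight time of `u` (part XX)
  have hU' := F.flowSlope_of_flat hSu hSv hUrep
  -- the window equations of the run of `v`
  set fv : Fin m → ℤ → ℝ → ℝ := fun i k t => quadTermOn shiftSet ε₀ α Sv i k t with hfvdef
  have hderiv : ∀ i k, F.InWindow k → ∀ t ∈ Icc 0 F.τhi,
      HasDerivWithinAt (fun s => Sv i k s) (fv i k t) (Icc 0 F.τhi) t := by
    intro i k hk t ht
    exact hSv.1.deriv i k (by have := hk.1; omega) (by have := hk.2; omega) t ht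
  -- the run slope (part XIII)
  obtain ⟨θ, hθ, hV⟩ := F.exists_runSlope hu hv hU' hderiv
  -- the shell-1 energies
  have hzu : ∀ i (j : Fin F.W), IntervalD.mem (F.runAt ε₀ α u i ((j : ℕ) : ℤ)) (IntervalD.aget kd.rs.Zb (ek (i, j))) :=
    fun i j => hHsZb _ (hhull _ hτu').1 (i, j)
  have hzv : ∀ i (j : Fin F.W), IntervalD.mem (F.runAt ε₀ α v i ((j : ℕ) : ℤ)) (IntervalD.aget kd.rs.Zb (ek (i, j))) :=
    fun i j => hHsZb _ (hhull _ hτv').2 (i, j)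
  have hidx1' : ∀ i : Fin m, ResSlopeD.natget kd.rs.idx1 i = (ek (i, ⟨1, hW1⟩) : ℕ) := fun i => by rw [hek]; exact M.hidx1 i
  have hEu : IntervalD.mem (∑ i, F.runAt ε₀ α u i 1 ^ 2) kd.rs.energyBox :=
    ResSlopeD.mem_energyBox_of ek hW1 M.hm hidx1' fun i => by simpa using hzu i ⟨1, hW1⟩
  have hEv : IntervalD.mem (∑ i, F.runAt ε₀ α v i 1 ^ 2) kd.rs.energyBox :=
    ResSlopeD.mem_energyBox_of ek hW1 M.hm hidx1' fun i => by simpa using hzv i ⟨1, hW1⟩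
  have he : 0 < ∑ i, F.runAt ε₀ α u i 1 ^ 2 := he0.trans_le hEu.1
  have he' : 0 < ∑ i, F.runAt ε₀ α v i 1 ^ 2 := he0.trans_le hEv.1
  -- the residual slope (part XI)
  have hW1' : F.InWindow 1 := ⟨by norm_num, by exact_mod_cast hW1⟩
  have hD' : F.InWindow F.D := ⟨by positivity, by exact_mod_cast hDW⟩
  obtain ⟨θ', ρ, hθ', hθ'pos, hρ, hrep⟩ := F.exists_residualSlope hW1' hD' hu hv huv he he'
    (F.runSlopeOf (F.slopeOfFlat U) (fun i k => fv i k (θ i k))) hV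
  refine ⟨θ', ρ, fun i k => fv i k (θ i k), U, ?_, hrep⟩
  -- the field values at the intermediate times lie in `Fv`
  have hφ : ∀ i (j : Fin F.W), IntervalD.mem (fv i ((j : ℕ) : ℤ) (θ i ((j : ℕ) : ℤ))) (IntervalD.aget kd.rs.Fv (ek (i, j))) := by
    intro i j
    set θ₀ := θ i ((j : ℕ) : ℤ) with hθ₀
    have hθ₀mem : θ₀ ∈ Icc (g.t g.S) F.τhi := (uIcc_subset_Icc hτv' hτu') (hθ i _ (F.inWindow_natCast j))
    set x := F.flatRun Sv θ₀ with hxdef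
    have hx : x ∈ boxSet (boxOf e (g.step g.S).Hs) := (hhull θ₀ hθ₀mem).2
    -- the derivative value is the rough field value
    have hval : fv i ((j : ℕ) : ℤ) θ₀ = termField (Tf u θ₀) x (i, j) := by
      rw [hTf u hu θ₀ x, hfvdef]
      show quadTermOn shiftSet ε₀ α Sv i ((j : ℕ) : ℤ) θ₀ = F.wfieldFlat ε₀ α (F.preclampTail u) θ₀ (F.flatRun Sv θ₀) (i, j)
      rw [quadTermOn_shiftSet, wfieldFlat, wfield, ← hT]
      exact quadTerm_congr_at (fun i' k => (F.assemble_curryS_flatRun hSv.2.2 θ₀ i' k).symm) i _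
    rw [hval, ← tjet_one]
    -- the order-1 interval jet of the rough field over the hull
    have hr : θ₀ - g.t g.S ∈ Ico 0 (g.h g.S).toReal := ⟨by linarith [hθ₀mem.1], by linarith [hθ₀mem.2, M.hTS]⟩
    have hRDS := hRD u hu g.S le_rfl (θ₀ - g.t g.S) hr
    rw [show g.t g.S + (θ₀ - g.t g.S) = θ₀ by ring] at hRDS
    have hSQ := isSQEnclosure_sqR (g.es e hn g.S) hRDS (g.step g.S).prec
    have hx' : x ∈ boxSet (boxOf (g.es e hn g.S) (g.step g.S).Hs) := by rw [GridD.boxOf_es]; exact hx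
    have hHB := (g.step g.S).toRoughStepD.centre.hboxMem_of_mem_boxOf (g.es e hn g.S) hwfH hx'
    have hcn : (e (i, j) : ℕ) < (g.step g.S).n := by rw [hn]; exact (e (i, j)).isLt
    have hmem := mem_tjet_of_jetLevelsA (Tf u θ₀) (g.es e hn g.S) hSQ (g.step g.S).prec 1 ((g.step g.S).toRoughStepD.centre.size_ext (g.step g.S).Hs) hHB
      (k := 1) le_rfl hcn
    have hsymm : (g.es e hn g.S).symm ⟨(e (i, j) : ℕ), hcn⟩ = (i, j) :=
      (g.es e hn g.S).symm_apply_eq.2 (Fin.ext (by simp))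
    rw [hsymm] at hmem
    rw [hek]
    exact IntervalD.mem_of_subset (hFv _ (e (i, j)).isLt) hmem
  -- the top tube at the flight time of `v`
  have hWout : ¬ F.InWindow (F.W : ℤ) := fun h => lt_irrefl _ h.2
  have hTtop : ∀ i, IntervalD.mem (F.preclampTail v i F.W (F.preclampTau v)) (IntervalD.aget kd.rs.Ttop i) := by
    intro i
    refine M.hTtop i _ ?_
    rw [F.preclampTail_eq_decodeTail hv.1 i hWout]
    exact hv.1.2.2.2.1 i F.W hWout _ (F.preclampTau_mem v)
  -- assemble `Matches`
  exact
    { hm := M.hm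
      hsucc := fun i j => by
        have h := M.hsucc i j
        rw [hek]
        rw [h]
        split_ifs with hj
        · rw [hek]
        · rfl
      hmode := fun i j => by rw [hek]; exact M.hmode i j
      hidx1 := hidx1'
      hidxD := fun i => by rw [hek]; exact M.hidxD i
      ha := fun i j => by rw [hek]; exact M.ha i j
      hrτ := M.hrτ
      hg := by
        unfold gfac
        exact mem_rsqrt_of_gCert hG he0 ⟨hEu.1, hEu.2⟩
      hγ := by
        refine mem_rsqrtDeriv_of_gamCert hGam he0 ?_
        have hsub := uIcc_subset_Icc (a₂ := kd.rs.energyBox.lo.toReal) (b₂ := kd.rs.energyBox.hi.toReal)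
          ⟨hEv.1, hEv.2⟩ ⟨hEu.1, hEu.2⟩
        exact hsub hθ'
      hz := hzu
      hz' := hzv
      hU := fun p q => by
        have h1 := hUV p q
        have hm : IntervalD.mem (U p q) (g.Vent (g.S + 1) (e p) (e q)) := ⟨h1.1, h1.2⟩
        have h2 := IntervalD.mem_of_subset (hUb _ (e p).isLt _ (e q).isLt) hm
        rw [hek, hek, hkn]
        exact h2
      hφ := hφ
      hρ := fun i => (hρ i).trans M.hRW
      hT := hTtop }

/-- **(K1) FROM THE GRID, THE KRAWCZYK ROWS AND THE LINK BOOLEAN.** For a one-shift frame `F` at `(ε₀, α)` (`ε₀ ≥ 0`,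
cancelling table, edge bounds), a grid `g` and a Krawczyk datum `kd` matching the frame (`FrameMatch`), term data
presenting the centre lists and every admissible realisation on every step (`hRDc`, `hRD` — the instance bridge),
and ALL Booleans true (`stepOK`, `linkOK`, `initOK`, `prodOK` per step; `linkK1`, which includes `KrawD.check` and the
range certificates): the contraction clause (K1) of part V holds with constant `Z = ZD` for the linear
preconditioner of the data matrix `Cmat`. [cite: Tao2016AveragedNS, §5.3; Moore1979, §3.2 and §8.1; WalawskaWilczak2016, §2.2 Lemma 2; cell vocabulary, harvest/h2-tao-ladder rung1/STAGE2-LEMMA.md §2–§3 (‖I − C·[DG]‖_∞ ≤ Z), rung1/KERNEL-CHEAP-REPLAY-SPEC.md §9 (G)] -/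
theorem K1_of_gridCE (hε : 0 ≤ ε₀) (hα : IsCancellingCoeff α)
    (hEb : ∀ i, |F.tubeC i (-1)| + F.tubeR (-1) ≤ F.Eb) (hEt : ∀ i, |F.tubeC i F.W| + F.tubeR F.W ≤ F.Et)
    (M : F.FrameMatch g.toGridD kd e R) (hkn : kd.rs.n = g.n)
    (Tc : ℕ → κ → BTerm F.SIdx) (rows : F.SIdx → List κ) (Tf : F.Space → ℝ → κ → BTerm F.SIdx)
    (hTf : ∀ u, F.AdmLip R u → ∀ t x, termField (Tf u t) x = F.wfieldFlat ε₀ α (F.preclampTail u) t x)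
    (hRDc : ∀ s ≤ g.S, IsRTEncl (g.es e M.hn s) (Tc s) (Tc s) rows (g.step s).RD)
    (hRD : ∀ u, F.AdmLip R u → ∀ s ≤ g.S, ∀ r ∈ Ico 0 (g.h s).toReal,
      IsRTEncl (g.es e M.hn s) (Tc s) (Tf u (g.t s + r)) rows (g.step s).RD)
    (hstep : ∀ s ≤ g.S, g.stepOK s = true) (hinit : g.initOK = true) (hprod : ∀ s < g.S, g.prodOKE s = true)
    (hprodS : g.prodOK g.S = true)
    (hpwf : ∀ s ≤ g.S, g.pwfOK s = true) (hpsub : ∀ s ≤ g.S, g.psubOK s = true)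
    (hplink : ∀ s < g.S, g.plinkOK s = true) (hwlink : ∀ s < g.S, g.wlinkOK s = true) (hK1 : g.linkK1 kd = true)
    (hP0 : (fun c : F.SIdx => F.yc c.1 ((c.2 : ℕ) : ℤ)) ∈ boxSet (boxOf e (g.P 0))) :
    ∀ u v, F.AdmLip R u → F.AdmLip R v → u.2.2 = v.2.2 →
      (∀ i j, |(u.1 i j - v.1 i j) -
        ((F.precondResidual ε₀ α (F.linOfMatrix (kd.CmatR F (e.trans (finCongr hkn.symm)))) u).1 i j -
         (F.precondResidual ε₀ α (F.linOfMatrix (kd.CmatR F (e.trans (finCongr hkn.symm)))) v).1 i j)| ≤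
          kd.ZD.toReal * dist u v) ∧
      |(u.2.1 - v.2.1) -
        ((F.precondResidual ε₀ α (F.linOfMatrix (kd.CmatR F (e.trans (finCongr hkn.symm)))) u).2 -
         (F.precondResidual ε₀ α (F.linOfMatrix (kd.CmatR F (e.trans (finCongr hkn.symm)))) v).2)| ≤
          kd.ZD.toReal * dist u v := by
  classical
  intro u v hu hv huv
  obtain ⟨-, -, -, -, -, -, -, hK⟩ := g.of_linkK1 hK1
  set ek : F.SIdx ≃ Fin kd.rs.n := e.trans (finCongr hkn.symm) with hekdef
  -- a `Matches` instance (the pair's own) for the static fields of `mag_row_of_check`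
  obtain ⟨θ', ρ, φ, U, Mt, -⟩ := F.exists_matches_of_gridCE hε hα hEb hEt M hkn Tc rows Tf hTf hRDc hRD hstep hinit hprod hprodS
    hpwf hpsub hplink hwlink hK1 hP0 hu hv huv
  obtain ⟨hMag, hrow⟩ := kd.mag_row_of_check F ek Mt hK
  refine F.K1_of_residualSlope (F.linOfMatrix (kd.CmatR F ek)) (F.coord_linOfMatrix (kd.CmatR F ek)) R
    (fun r c => (kd.rs.Nb (kd.rs.eO F ek r) (kd.rs.eO F ek c)).lo.toReal)
    (fun r c => (kd.rs.Nb (kd.rs.eO F ek r) (kd.rs.eO F ek c)).hi.toReal) (kd.MagR F ek) ?_ hMag hrow u v hu hv huv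
  -- the residual slope of every pair lies in `[Nb]`
  intro u' v' hu' hv' huv'
  obtain ⟨θ₁, ρ₁, φ₁, U₁, M₁, hrep⟩ := F.exists_matches_of_gridCE hε hα hEb hEt M hkn Tc rows Tf hTf hRDc hRD hstep hinit
    hprod hprodS hpwf hpsub hplink hwlink hK1 hP0 hu' hv' huv'
  refine ⟨_, fun r c => ?_, hrep⟩
  have h := ResSlopeD.mem_resSlope M₁ r c
  exact ⟨h.1, h.2⟩

end Glue

end OneShiftFrame

end DSSOneShift

end Summit.NavierStokesRegularity.NavierStokesRegularity.Theorems
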